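import Summits.AtomisticToContinuum.BoseEinsteinCondensation.Theses.BECFeynmanVortexArea
import Summits.AtomisticToContinuum.BoseEinsteinCondensation.Theses.BECChargeConjugationRP
import Literature.MathematicalPhysics.QuantumManyBody.GroundState

/-!
# Birth skeleton for the crux `ScatteringLengthTransfer` (stmt-AtomisticToContinuum-9048)

Route: `route-AtomisticToContinuum-BECFeynmanVortexArea` (crux shared verbatim with
BECEqualScatteringTransfer / BECChargeConjugationRP / BECPhaseQuadratureSumRule).

Crux (fixed, by name): for admissible `v` (bounded) and `w` (arbitrary: hard cores allowed) with
`scatteringLength v = scatteringLength w`, small-density Dirichlet ground-state BEC for `v` implies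
small-density ground-state BEC for `w`.

LINE "soften the target at fixed volume, identify the order parameter with the ground state,
transfer uniformly among bounded potentials":

* `stub_equalScatteringSoftApproximation` (ESA; fixed `(N, L)`, dilute corner; the ONLY place where
  hard cores are met): every admissible `w` is approximated by BOUNDED admissible potentials `u n`
  of a common range `≤ R` and the SAME scattering length (`min(w,n)` plus a compensating bounded
  shell fixed by the intermediate value theorem; `a(min(w,n)) ↑ a(w)`, FGJMOT Lemma 3.3 in the
  tree), such that at every fixed dilute volume the condensate number of `w` dominates every common
  lower bound of those of the `u n` (monotone convergence of the closed forms, norm-resolvent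
  convergence at fixed `(N, L)`, simplicity of the Dirichlet ground state below close packing,
  `L²`-Lipschitz continuity of `λ_max(γ)`).
* `stub_condensateNumber_groundState` (CGS; fixed `(N, L)`, bounded potentials; provable functional
  analysis): for a bounded admissible `u`, `N ≥ 1`, `L > 0`, a Dirichlet ground state exists and
  `condensateNumber u N L = λ_max(γ_Ψ)` for EVERY ground state `Ψ` (Rellich compactness on `Λ_L^N`,
  Perron–Frobenius simplicity for bounded `V`, spectral gap ⇒ near-minimisers converge modulo a
  phase, `λ_max` is `L²`-Lipschitz on the unit ball).
* `stub_uniformGroundStateTransfer` (GUT; the thermodynamic-limit heart, bounded potentials only,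
  stated on GROUND STATES): if the ground states of the bounded source `v` at density `ρ < ρ₁(v, R)`
  carry `λ_max ≥ c₀ N` eventually, then ONE constant `c` and ONE threshold in `N` give
  `λ_max(γ_Φ) ≥ c N` for every ground state `Φ` of EVERY bounded admissible `u` of range `≤ R` with
  `scatteringLength u = scatteringLength v` (equal-`a` Dyson–Jastrow dressing of positive ground
  states; the non-universal correction to the condensate fraction is of relative order `ρ a² R`,
  uniformly over the class; the BEC hypothesis is usable only through ground-state structure, never
  through energy slack).
* `ScatteringLengthTransfer_of`: ESA → CGS → GUT → crux (choose `ρ < min(ρ₀, ρ₁^ESA, ρ₁^GUT)`; CGS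
  turns BEC of `v` into the ground-state hypothesis of GUT and GUT's conclusion back into condensate
  numbers of each approximant `u n` along `L = (N/ρ)^{1/3}`, where `N/L³ = ρ`; ESA passes to `w` at
  each fixed `N`). Sorry-free (axioms propext / Classical.choice / Quot.sound); concludes the payload
  route's decl `…Theses.BECFeynmanVortexArea.ScatteringLengthTransfer` BY NAME.
* `ScatteringLengthTransfer_proof`: the registration form expected by `ledger skeleton check` — the
  crux decl of the item's primary route file (`…Theses.BECChargeConjugationRP.ScatteringLengthTransfer`,
  definitionally equal to the other three route copies of this shared crux) obtained from `_of` and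
  the three sorried stubs; it inherits their `sorry` and is NOT a proof.
-/

namespace Summit.AtomisticToContinuum.BoseEinsteinCondensation.Cruxes.ScatteringLengthTransfer.Birth

open Filter

/-- **ESA — equal-scattering-length soft approximation at fixed volume.** For every admissible
`w` there are a dilute threshold `ρ₁ > 0`, a range bound `R > 0` and bounded admissible potentials
`u n` (`n : ℕ`) of range `≤ R` with `scatteringLength (u n) = scatteringLength w`, such that for all
`N` and `L > 0` with `N / L³ < ρ₁`, every common lower bound of the condensate numbers of the `u n`
is a lower bound of the condensate number of `w` (i.e. `cn w N L ≥ inf_n cn (u n) N L`; for bounded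
`w` take `u n = w`). Size: XL in Lean (monotone form convergence, compactness at fixed volume),
no open mathematics. -/
theorem stub_equalScatteringSoftApproximation :
    ∀ w : ℝ → ENNReal,
      Literature.MathematicalPhysics.QuantumManyBody.BoseGas.IsRepulsiveFiniteRange w →
      ∃ ρ₁ : ℝ, 0 < ρ₁ ∧ ∃ R : ℝ, 0 < R ∧ ∃ u : ℕ → ℝ → ENNReal,
        (∀ n, Literature.MathematicalPhysics.QuantumManyBody.BoseGas.IsRepulsiveFiniteRange (u n) ∧
          (∃ M : NNReal, ∀ r, u n r ≤ M) ∧ (∀ r, R < r → u n r = 0) ∧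
          Literature.MathematicalPhysics.QuantumManyBody.BoseGas.scatteringLength (u n) =
            Literature.MathematicalPhysics.QuantumManyBody.BoseGas.scatteringLength w) ∧
        ∀ (N : ℕ) (L : ℝ), 0 < L → (N : ℝ) / L ^ 3 < ρ₁ → ∀ m : ENNReal,
          (∀ n, m ≤ Literature.MathematicalPhysics.QuantumManyBody.BoseGas.condensateNumber (u n) N L) →
          m ≤ Literature.MathematicalPhysics.QuantumManyBody.BoseGas.condensateNumber w N L := by
  sorry

/-- **CGS — the condensate number is `λ_max` of the ground state (bounded potentials).** For a
bounded admissible `u`, every `N ≥ 1` and `L > 0`: a Dirichlet ground state of `H_N` on `Λ_L^N`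
exists (`IsGroundState`), and `condensateNumber u N L = maxOccupation N Ψ` for every ground state
`Ψ` (so all ground states share `λ_max(γ)` — simplicity modulo a phase). Size: XL in Lean (Rellich
compactness, Perron–Frobenius for bounded `V`, gap ⇒ convergence of near-minimisers,
`L²`-Lipschitz continuity of `maxOccupation`), no open mathematics; shared infrastructure with
BECEqualScatteringTransfer's layer 2. -/
theorem stub_condensateNumber_groundState :
    ∀ u : ℝ → ENNReal,
      Literature.MathematicalPhysics.QuantumManyBody.BoseGas.IsRepulsiveFiniteRange u →
      (∃ M : NNReal, ∀ r, u r ≤ M) → ∀ N : ℕ, 0 < N → ∀ L : ℝ, 0 < L →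
        (∃ Ψ : Literature.MathematicalPhysics.QuantumManyBody.BoseGas.Config N → ℂ,
          Literature.MathematicalPhysics.QuantumManyBody.BoseGas.IsGroundState u L Ψ) ∧
        ∀ Ψ : Literature.MathematicalPhysics.QuantumManyBody.BoseGas.Config N → ℂ,
          Literature.MathematicalPhysics.QuantumManyBody.BoseGas.IsGroundState u L Ψ →
          Literature.MathematicalPhysics.QuantumManyBody.BoseGas.condensateNumber u N L =
            Literature.MathematicalPhysics.QuantumManyBody.BoseGas.maxOccupation N Ψ := by
  sorry

/-- **GUT — uniform ground-state transfer along the thermodynamic sequence (bounded potentials).**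
For a bounded admissible source `v` and a range bound `R > 0` there is `ρ₁ > 0` such that for every
density `0 < ρ < ρ₁` and every `c₀ > 0`: if eventually in `N` some ground state of `v` in the box of
side `(N/ρ)^{1/3}` has `λ_max(γ) ≥ c₀ N`, then ONE constant `c > 0` and ONE threshold in `N` give
`λ_max(γ_Φ) ≥ c N` for every ground state `Φ` of EVERY bounded admissible `u` of range `≤ R` with
`scatteringLength u = scatteringLength v`. Size: open-problem level (the N-uniform equal-`a`
corrector bound), but for bounded potentials only and in ground-state currency. -/
theorem stub_uniformGroundStateTransfer :
    ∀ v : ℝ → ENNReal,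
      Literature.MathematicalPhysics.QuantumManyBody.BoseGas.IsRepulsiveFiniteRange v →
      (∃ M : NNReal, ∀ r, v r ≤ M) → ∀ R : ℝ, 0 < R → ∃ ρ₁ : ℝ, 0 < ρ₁ ∧
        ∀ ρ : ℝ, 0 < ρ → ρ < ρ₁ → ∀ c₀ : ℝ, 0 < c₀ →
          (∀ᶠ N : ℕ in Filter.atTop,
            ∃ Ψ : Literature.MathematicalPhysics.QuantumManyBody.BoseGas.Config N → ℂ,
              Literature.MathematicalPhysics.QuantumManyBody.BoseGas.IsGroundState v
                (Literature.MathematicalPhysics.QuantumManyBody.BoseGas.sideLength ρ N) Ψ ∧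
              ENNReal.ofReal (c₀ * N) ≤
                Literature.MathematicalPhysics.QuantumManyBody.BoseGas.maxOccupation N Ψ) →
          ∃ c : ℝ, 0 < c ∧ ∀ᶠ N : ℕ in Filter.atTop, ∀ u : ℝ → ENNReal,
            Literature.MathematicalPhysics.QuantumManyBody.BoseGas.IsRepulsiveFiniteRange u →
            (∃ M : NNReal, ∀ r, u r ≤ M) → (∀ r, R < r → u r = 0) →
            Literature.MathematicalPhysics.QuantumManyBody.BoseGas.scatteringLength u =
              Literature.MathematicalPhysics.QuantumManyBody.BoseGas.scatteringLength v →
            ∀ Φ : Literature.MathematicalPhysics.QuantumManyBody.BoseGas.Config N → ℂ,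
              Literature.MathematicalPhysics.QuantumManyBody.BoseGas.IsGroundState u
                (Literature.MathematicalPhysics.QuantumManyBody.BoseGas.sideLength ρ N) Φ →
              ENNReal.ofReal (c * N) ≤
                Literature.MathematicalPhysics.QuantumManyBody.BoseGas.maxOccupation N Φ := by
  sorry

/-- **Assembly of the line**: ESA → CGS → GUT → `ScatteringLengthTransfer` (the route decl, by
name). Given `v, w` with equal scattering length and BEC of `v` below `ρ₀`: ESA for `w` gives
`ρ₁, R, u`; GUT for `v, R` gives `ρ₂`; for `ρ < min ρ₀ (min ρ₁ ρ₂)`, CGS turns BEC of `v` at `ρ`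
into the ground-state hypothesis of GUT, GUT gives `c` and, eventually in `N`, `λ_max ≥ c N` for the
ground states of every `u n` (`a(u n) = a(w) = a(v)`), CGS turns that into
`c N ≤ condensateNumber (u n) N L_N`, and ESA at the fixed dilute volume `L_N = (N/ρ)^{1/3}`
(`N / L_N³ = ρ < ρ₁`) transfers the bound to `w`. -/
theorem ScatteringLengthTransfer_of :
    (∀ w : ℝ → ENNReal,
      Literature.MathematicalPhysics.QuantumManyBody.BoseGas.IsRepulsiveFiniteRange w →
      ∃ ρ₁ : ℝ, 0 < ρ₁ ∧ ∃ R : ℝ, 0 < R ∧ ∃ u : ℕ → ℝ → ENNReal,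
        (∀ n, Literature.MathematicalPhysics.QuantumManyBody.BoseGas.IsRepulsiveFiniteRange (u n) ∧
          (∃ M : NNReal, ∀ r, u n r ≤ M) ∧ (∀ r, R < r → u n r = 0) ∧
          Literature.MathematicalPhysics.QuantumManyBody.BoseGas.scatteringLength (u n) =
            Literature.MathematicalPhysics.QuantumManyBody.BoseGas.scatteringLength w) ∧
        ∀ (N : ℕ) (L : ℝ), 0 < L → (N : ℝ) / L ^ 3 < ρ₁ → ∀ m : ENNReal,
          (∀ n, m ≤ Literature.MathematicalPhysics.QuantumManyBody.BoseGas.condensateNumber (u n) N L) →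
          m ≤ Literature.MathematicalPhysics.QuantumManyBody.BoseGas.condensateNumber w N L) →
    (∀ u : ℝ → ENNReal,
      Literature.MathematicalPhysics.QuantumManyBody.BoseGas.IsRepulsiveFiniteRange u →
      (∃ M : NNReal, ∀ r, u r ≤ M) → ∀ N : ℕ, 0 < N → ∀ L : ℝ, 0 < L →
        (∃ Ψ : Literature.MathematicalPhysics.QuantumManyBody.BoseGas.Config N → ℂ,
          Literature.MathematicalPhysics.QuantumManyBody.BoseGas.IsGroundState u L Ψ) ∧
        ∀ Ψ : Literature.MathematicalPhysics.QuantumManyBody.BoseGas.Config N → ℂ,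
          Literature.MathematicalPhysics.QuantumManyBody.BoseGas.IsGroundState u L Ψ →
          Literature.MathematicalPhysics.QuantumManyBody.BoseGas.condensateNumber u N L =
            Literature.MathematicalPhysics.QuantumManyBody.BoseGas.maxOccupation N Ψ) →
    (∀ v : ℝ → ENNReal,
      Literature.MathematicalPhysics.QuantumManyBody.BoseGas.IsRepulsiveFiniteRange v →
      (∃ M : NNReal, ∀ r, v r ≤ M) → ∀ R : ℝ, 0 < R → ∃ ρ₁ : ℝ, 0 < ρ₁ ∧
        ∀ ρ : ℝ, 0 < ρ → ρ < ρ₁ → ∀ c₀ : ℝ, 0 < c₀ →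
          (∀ᶠ N : ℕ in Filter.atTop,
            ∃ Ψ : Literature.MathematicalPhysics.QuantumManyBody.BoseGas.Config N → ℂ,
              Literature.MathematicalPhysics.QuantumManyBody.BoseGas.IsGroundState v
                (Literature.MathematicalPhysics.QuantumManyBody.BoseGas.sideLength ρ N) Ψ ∧
              ENNReal.ofReal (c₀ * N) ≤
                Literature.MathematicalPhysics.QuantumManyBody.BoseGas.maxOccupation N Ψ) →
          ∃ c : ℝ, 0 < c ∧ ∀ᶠ N : ℕ in Filter.atTop, ∀ u : ℝ → ENNReal,
            Literature.MathematicalPhysics.QuantumManyBody.BoseGas.IsRepulsiveFiniteRange u →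
            (∃ M : NNReal, ∀ r, u r ≤ M) → (∀ r, R < r → u r = 0) →
            Literature.MathematicalPhysics.QuantumManyBody.BoseGas.scatteringLength u =
              Literature.MathematicalPhysics.QuantumManyBody.BoseGas.scatteringLength v →
            ∀ Φ : Literature.MathematicalPhysics.QuantumManyBody.BoseGas.Config N → ℂ,
              Literature.MathematicalPhysics.QuantumManyBody.BoseGas.IsGroundState u
                (Literature.MathematicalPhysics.QuantumManyBody.BoseGas.sideLength ρ N) Φ →
              ENNReal.ofReal (c * N) ≤
                Literature.MathematicalPhysics.QuantumManyBody.BoseGas.maxOccupation N Φ) →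
    Summit.AtomisticToContinuum.BoseEinsteinCondensation.Theses.BECFeynmanVortexArea.ScatteringLengthTransfer := by
  intro hESA hCGS hGUT v w hv hw hvM hvw hBECv
  obtain ⟨ρ₀, hρ₀, hBEC⟩ := hBECv
  obtain ⟨ρ₁, hρ₁, R, hR, u, hu, hstab⟩ := hESA w hw
  obtain ⟨ρ₂, hρ₂, hT⟩ := hGUT v hv hvM R hR
  refine ⟨min ρ₀ (min ρ₁ ρ₂), lt_min hρ₀ (lt_min hρ₁ hρ₂), fun ρ hρ hρlt => ?_⟩
  have h0 : ρ < ρ₀ := hρlt.trans_le (min_le_left _ _)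
  have h1 : ρ < ρ₁ := hρlt.trans_le ((min_le_right _ _).trans (min_le_left _ _))
  have h2 : ρ < ρ₂ := hρlt.trans_le ((min_le_right _ _).trans (min_le_right _ _))
  -- side lengths are positive along the thermodynamic sequence
  have hL : ∀ N : ℕ, 0 < N →
      0 < Literature.MathematicalPhysics.QuantumManyBody.BoseGas.sideLength ρ N := fun N hN => by
    unfold Literature.MathematicalPhysics.QuantumManyBody.BoseGas.sideLength
    exact Real.rpow_pos_of_pos (div_pos (Nat.cast_pos.mpr hN) hρ) _
  -- BEC of `v` at density `ρ`, read on ground states through CGS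
  obtain ⟨c₀, hc₀, hev₀⟩ := hBEC ρ hρ h0
  have hGSv : ∀ᶠ N : ℕ in Filter.atTop,
      ∃ Ψ : Literature.MathematicalPhysics.QuantumManyBody.BoseGas.Config N → ℂ,
        Literature.MathematicalPhysics.QuantumManyBody.BoseGas.IsGroundState v
          (Literature.MathematicalPhysics.QuantumManyBody.BoseGas.sideLength ρ N) Ψ ∧
        ENNReal.ofReal (c₀ * N) ≤
          Literature.MathematicalPhysics.QuantumManyBody.BoseGas.maxOccupation N Ψ := by
    filter_upwards [hev₀, Filter.eventually_gt_atTop 0] with N hN hNpos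
    obtain ⟨⟨Ψ, hΨ⟩, hid⟩ := hCGS v hv hvM N hNpos _ (hL N hNpos)
    exact ⟨Ψ, hΨ, hN.trans_eq (hid Ψ hΨ)⟩
  -- uniform transfer to the bounded equal-`a` class of range `≤ R`
  obtain ⟨c, hc, hev⟩ := hT ρ hρ h2 c₀ hc₀ hGSv
  refine ⟨c, hc, ?_⟩
  filter_upwards [hev, Filter.eventually_gt_atTop 0] with N hN hNpos
  have hdens : (N : ℝ) / Literature.MathematicalPhysics.QuantumManyBody.BoseGas.sideLength ρ N ^ 3 < ρ₁ := by
    rw [Literature.MathematicalPhysics.QuantumManyBody.BoseGas.div_sideLength_pow_three hρ hNpos]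
    exact h1
  -- pass to `w` at the fixed dilute volume through the soft approximants
  refine hstab N _ (hL N hNpos) hdens _ fun n => ?_
  obtain ⟨hun, hunM, hunR, huna⟩ := hu n
  obtain ⟨⟨Φ, hΦ⟩, hid⟩ := hCGS (u n) hun hunM N hNpos _ (hL N hNpos)
  rw [hid Φ hΦ]
  exact hN (u n) hun hunM hunR (huna.trans hvw.symm) Φ hΦ

/-- **Registration form** (what `ledger skeleton check` looks for: `theorem <Crux>_proof : <CruxDecl>`
with the item's decl in its primary route file, BECChargeConjugationRP; the four route copies of
this shared crux are definitionally equal, so the `_of` term for the BECFeynmanVortexArea copy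
elaborates at this type). It USES the three sorried stubs and is therefore NOT a proof of the crux —
only the certificate that the stubs compose to it. -/
theorem ScatteringLengthTransfer_proof :
    Summit.AtomisticToContinuum.BoseEinsteinCondensation.Theses.BECChargeConjugationRP.ScatteringLengthTransfer :=
  ScatteringLengthTransfer_of stub_equalScatteringSoftApproximation stub_condensateNumber_groundState
    stub_uniformGroundStateTransfer

end Summit.AtomisticToContinuum.BoseEinsteinCondensation.Cruxes.ScatteringLengthTransfer.Birth
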